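import Summits.CriticalPhenomena.PercolationContinuityZ3.Theorems.Transplant.SkelFrmBParamsFaceTop
import Summits.CriticalPhenomena.PercolationContinuityZ3.Theorems.Transplant.SkelFrmBParamsFaceUnits
import Summits.CriticalPhenomena.PercolationContinuityZ3.Theorems.Transplant.SkelFrmBParamsSchedA
import Summits.CriticalPhenomena.PercolationContinuityZ3.Theorems.Transplant.SkelFrmBParamsSlotsTA
import Summits.CriticalPhenomena.PercolationContinuityZ3.Theorems.Transplant.SkelFrmBParamsFineSizeA
import Summits.CriticalPhenomena.PercolationContinuityZ3.Theorems.Transplant.SkelFrmBParamsLOA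
import Summits.CriticalPhenomena.PercolationContinuityZ3.Theorems.Transplant.SkelNegBParamsFaceTopA
import HarnessLib

/-!
# N2 (frames-only node `SamePDropOfSkeletonFrm₁`, OPEN) params column over `PlanarSkeletonFrm` — (ζ″) ledger, shape (B′) of record ((R-14)):
# MECHANICAL PORT of N1's `SkelNegBParamsFaceTopA` — (ζ′) chain (`A := NegB.Aof κ = 800·Kq`), part FaceTopA: THE (F) NUMBERS LAYER'S LATTICE BINDERS AT THE (ζ′) RECORD
# `prFA` — the A-twin of part FaceTop §1 (stmt-g15): hp-8's keystone binders `hA hc0 hc1 hκ₀ hmod0 hD hDd hv hnL hmodlo hmodhi` served at `prFA = ⟨A, n_L, h_L, v_L, v_β,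
# A·u₀A, A·u₁A, … (N1 title abridged; see `SkelNegBParamsFaceTopA`)
builds on p205010 (kernel theorem, internal audit signed; external expert review pending) — nothing in this file uses p205010; NOTHING is claimed about the
open node `SamePDropOfSkeletonFrm₁` (`SamePDropOfSkeletonNeg₁` is CLOSED in the tree and untouched by this file).
Status sentence (coordinator 2026-08-20T04:30Z): "θ(p_c) = 0 on ℤ^d, all d ≥ 2 — kernel-verified (Lean 4/Mathlib, standard axioms); internal adversarial
audit SIGNED 2026-08-20 04:29Z; external expert review pending."
Lane `prim-bschramm-*`, seat `prim-bschramm-p1` (gen 17; (F) value layer, lead g11 06:35:07Z) running stmt-g19's port tool of record; helper file (`--supports stmt-CriticalPhenomena-4575 --as helper`); ledger HOME/prim-bschramm-stmt/FRM-PARAMS.md §9, (R-14).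
PORT RULES (HOME/prim-bschramm-stmt-g19/lean/port_frm.py, the tool of record per (R-14)): outer namespace `PlanarSkeletonNeg ↦ PlanarSkeletonFrm`, carrier binder
`(Φ : PlanarSkeletonFrm G)`, record binder `(D : Skelφ.StepI.DataNS V)` (the selectors travel IN the record, `SkelPhiStepIDataNS`); section variables INLINED into every
declaration header; inner namespaces (`Neg`/`NegB`/`KS`/…) and every short name KEPT so all cross-references resolve unchanged; declarations using no section variable are
NOT re-declared (N1's originals are referenced fully qualified). Mathematical content, proofs, docstrings and citations are N1's, verbatim, except where stated next.
SELECTORS IN THIS FILE ((R-14) condition of record — joint selection, `D.sN`'s first argument is the literal handed to `D.sM`): none (pure port; the pairs are read through their N1 names).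
N1 HEADER (kept for the reader):
helper file (`--supports stmt-CriticalPhenomena-4575 --as helper`).
* §1 `c₀_eq_A_mul_u₀A`, `c₁_eq_A_mul_u₁A`, `u_nonnegA`, `D_eq_A_sq_mulA`, **`lattice_RA`** (the bundle at `prFA`).
[cite: KozmaNitzan2024, §4 Lemma 10 (pp. 17–21), Lemma 12 (pp. 23–25)] [cite: MartineauTassion2017, §4.1, §4.3 Lemma 4.2]
-/

noncomputable section

open scoped Classical

namespace Summit.CriticalPhenomena.PercolationContinuityZ3.Theorems.Transplant

namespace PlanarSkeletonFrm

namespace NegB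

open Literature.Probability.Percolation Literature.Probability.LatticeModels SimpleGraph
open SkelConc (Consts)
open Skelφ (shearUnit)
open Skelφ.StepI (DataN)
open TwoAxis.Para (modulus)
open Neg

/-! ## §1 The (ζ′) lattice record's unit / determinant / top-layer facts -/

section Lattice

/-- **`c₀ = A·u₀A`** (hp-8's `hc0` with `κ₀ := u₀A = s₀`). [folklore] -/
theorem c₀_eq_A_mul_u₀A (κ : Consts) {V : Type} [DecidableEq V] [Countable V] {G : SimpleGraph V} [G.LocallyFinite] (Φ : PlanarSkeletonFrm G) (t : V) (p : unitInterval) (D : Skelφ.StepI.DataNS V) (g : ℕ) (f : ℕ) : (prFA κ Φ t p D g f).c₀ = (prFA κ Φ t p D g f).A * KS.u₀A κ Φ t p D g f := by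
  rw [(prFA_fields κ Φ t p D g f).2.2.2.2.2.1, (prFA_fields κ Φ t p D g f).1]; exact (KS.units_eqA κ Φ t p D g f).1

/-- **`c₁ = A·u₁A`** (hp-8's `hc1` with `κ₁ := u₁A = s₁`). [folklore] -/
theorem c₁_eq_A_mul_u₁A (κ : Consts) {V : Type} [DecidableEq V] [Countable V] {G : SimpleGraph V} [G.LocallyFinite] (Φ : PlanarSkeletonFrm G) (t : V) (p : unitInterval) (D : Skelφ.StepI.DataNS V) (g : ℕ) (f : ℕ) : (prFA κ Φ t p D g f).c₁ = (prFA κ Φ t p D g f).A * KS.u₁A κ Φ t p D g f := by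
  rw [(prFA_fields κ Φ t p D g f).2.2.2.2.2.2.1, (prFA_fields κ Φ t p D g f).1]; exact (KS.units_eqA κ Φ t p D g f).2.1

/-- `0 ≤ u₀A`, `0 ≤ u₁A` (indeed `1 ≤ u_iA`). [folklore] -/
theorem u_nonnegA (κ : Consts) {V : Type} [DecidableEq V] [Countable V] {G : SimpleGraph V} [G.LocallyFinite] (Φ : PlanarSkeletonFrm G) (t : V) (p : unitInterval) (D : Skelφ.StepI.DataNS V) (g : ℕ) (f : ℕ) : 0 ≤ KS.u₀A κ Φ t p D g f ∧ 0 ≤ KS.u₁A κ Φ t p D g f := by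
  obtain ⟨-, -, -, -, h0, h1⟩ := KS.units_eqA κ Φ t p D g f
  exact ⟨by linarith, by linarith⟩

/-- **`D_A = A²·m`** at the record's own fields (hp-8's `hD` with `mod := modulus n_L h_L v_L v_β`). [folklore] -/
theorem D_eq_A_sq_mulA (κ : Consts) {V : Type} [DecidableEq V] [Countable V] {G : SimpleGraph V} [G.LocallyFinite] (Φ : PlanarSkeletonFrm G) (t : V) (p : unitInterval) (D : Skelφ.StepI.DataNS V) (g : ℕ) (f : ℕ) : (prFA κ Φ t p D g f).D =
    (prFA κ Φ t p D g f).A ^ 2 * modulus ((prFA κ Φ t p D g f).n : ℤ) (prFA κ Φ t p D g f).h (prFA κ Φ t p D g f).vα (prFA κ Φ t p D g f).vβ := by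
  obtain ⟨hA, hn, hh, hv, hvb, -, -, hD⟩ := prFA_fields κ Φ t p D g f
  rw [hD, hA, hn, hh, hv, hvb]; exact KS.DofA_eq' κ Φ t p D g f

/-- **THE (ζ′) LATTICE BUNDLE AT THE LEDGER** (under the numeric long clause): `0 < A`, `c₀ = A·u₀A`, `c₁ = A·u₁A`, `0 ≤ u₀A`, `0 ≤ u₁A`, `0 < m`,
`D_A = A²·m`, `D_A = detD A n h v_α v_β`, `|v_L| ≤ n_L`, `1 ≤ n_L`, `1 ≤ ℓ_L`, and the top-layer sandwich — hp-8's `hA0/hA, hc0, hc1, hκ₀, hmf/hmod0, hD, hDd,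
hvL/hv, hnL, hmodlo, hmodhi` at `prFA`. [folklore] -/
theorem lattice_RA (κ : Consts) {V : Type} [DecidableEq V] [Countable V] {G : SimpleGraph V} [G.LocallyFinite] (Φ : PlanarSkeletonFrm G) (t : V) (p : unitInterval) (D : Skelφ.StepI.DataNS V) (g : ℕ) (f : ℕ) (hN : EqNumL κ Φ t p D g f) :
    0 < (prFA κ Φ t p D g f).A ∧ (prFA κ Φ t p D g f).c₀ = (prFA κ Φ t p D g f).A * KS.u₀A κ Φ t p D g f ∧
      (prFA κ Φ t p D g f).c₁ = (prFA κ Φ t p D g f).A * KS.u₁A κ Φ t p D g f ∧ 0 ≤ KS.u₀A κ Φ t p D g f ∧ 0 ≤ KS.u₁A κ Φ t p D g f ∧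
      0 < modulus (nL κ Φ t p D g f) (hL κ Φ t p D g f) (vL κ Φ t p D g f) (vβL κ Φ t p D g f) ∧
      (prFA κ Φ t p D g f).D = (prFA κ Φ t p D g f).A ^ 2 * modulus (nL κ Φ t p D g f) (hL κ Φ t p D g f) (vL κ Φ t p D g f) (vβL κ Φ t p D g f) ∧
      (prFA κ Φ t p D g f).D =
        TwoAxis.Para.detD (prFA κ Φ t p D g f).A (prFA κ Φ t p D g f).n (prFA κ Φ t p D g f).h (prFA κ Φ t p D g f).vα (prFA κ Φ t p D g f).vβ ∧
      |vL κ Φ t p D g f| ≤ (nL κ Φ t p D g f : ℤ) ∧ 1 ≤ nL κ Φ t p D g f ∧ 1 ≤ ℓL κ Φ t p D g f ∧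
      (nL κ Φ t p D g f : ℤ) * ℓL κ Φ t p D g f - (shearUnit (nL κ Φ t p D g f) (hL κ Φ t p D g f) : ℤ) + 1 ≤
        modulus (nL κ Φ t p D g f) (hL κ Φ t p D g f) (vL κ Φ t p D g f) (vβL κ Φ t p D g f) ∧
      modulus (nL κ Φ t p D g f) (hL κ Φ t p D g f) (vL κ Φ t p D g f) (vβL κ Φ t p D g f) ≤ (nL κ Φ t p D g f : ℤ) * ℓL κ Φ t p D g f := by
  obtain ⟨hn1, hℓ1⟩ := one_le_of_eqNumL κ Φ t p D g f hN
  obtain ⟨hA, hn, hh, hv, hvb, -, -, hD⟩ := prFA_fields κ Φ t p D g f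
  have hm : 0 < modulus (nL κ Φ t p D g f) (hL κ Φ t p D g f) (vL κ Φ t p D g f) (vβL κ Φ t p D g f) :=
    Skelφ.NegPrm.modulus_vβOf_pos hn1 hℓ1 _ _
  obtain ⟨hlo, hhi⟩ := modulus_top κ Φ t p D g f hn1
  have hDm : (prFA κ Φ t p D g f).D = (prFA κ Φ t p D g f).A ^ 2 * modulus (nL κ Φ t p D g f) (hL κ Φ t p D g f) (vL κ Φ t p D g f) (vβL κ Φ t p D g f) := by
    rw [hD, hA]; exact KS.DofA_eq' κ Φ t p D g f
  exact ⟨by rw [hA]; exact (Aof_pos κ).1, c₀_eq_A_mul_u₀A κ Φ t p D g f, c₁_eq_A_mul_u₁A κ Φ t p D g f, (u_nonnegA κ Φ t p D g f).1,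
    (u_nonnegA κ Φ t p D g f).2, hm, hDm, prFA_D κ Φ t p D g f, hN.v_le, hn1, hℓ1, hlo, hhi⟩

end Lattice

end NegB

end PlanarSkeletonFrm

end Summit.CriticalPhenomena.PercolationContinuityZ3.Theorems.Transplant

end
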